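import Literature.NumberTheory.ConnesConsani2024.ProlateWaveMomentsJacobi
import HarnessLib

/-!
# Connes–Consani–Moscovici 2024, Theorem 3.1 (ii) PROVED: the Hardy–Titchmarsh polynomials `𝒫_n` are orthonormal in
# `L²(ℝ, dm)`, `dm = (2π)^{−3/2}|Γ(¼ + is/2)|² ds` — by Favard's mechanism from the moments and the recurrence

LINE 1 — FRAMING: RH-FREE corpus literature (orthogonality of explicit polynomials for an explicit probability measure;
nothing here bears on the truth of RH); cell rh-crit, corpus C1, seat t14 (discharge of seat t12's named fact
`CCM2024_thm_3_1_ii`, claimed on the ledger, t12 ACK 06:37Z); bears_on: W-C/W-P (sequel, no leaf role).  WHAT THIS IS NOT: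
any claim about RH, any new definition or named fact (theorems only).

Source: A. Connes, C. Consani, H. Moscovici, *Zeta zeros and prolate wave operators*, Ann. Funct. Anal. 15 (2024) =
arXiv:2310.18423 [bib: `ConnesConsaniMoscovici2024`] (held text `paper:arxiv-2310.18423`): Thm. 3.1 (ii) p. 9 (p0008:L9)
"`𝒰(h_{2n}) = (−1)ⁿ𝒫_n𝒰(h_0)` where the `𝒫_n` are the orthonormal polynomials for the measure `dm`", Prop. 3.3 (i)–(ii)
p. 11–12 (p0009:L27, L90), §2 p. 6–8 (the general theory: Jacobi matrix (9), moments «(Szego)»), Thm 5.2 (iii) p0018:L71.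

## Route (deviation from print, which uses the unitarity of the Mellin transform `𝒰`)

The printed orthonormality is a by-product of Mellin–Plancherel (Thm 3.1 (iii)–(iv)).  Here it is derived from two tree
theorems by the converse ("Favard") direction of the general theory of §2: (a) the moments of `dm` are the Jacobi moments
`c_n = (Aⁿ)_{00}` of `a_n = ½√((2n+1)(2n+2))` (`integral_pow_gammaQuarterMeasure_eq_metaMoment`, this seat's
`ProlateWaveMomentsJacobi.lean`, over seat t10's characteristic function «(moments1)»), so that `∫ p dm = (p(A)δ_0)_0` for
every polynomial `p` (`integral_eval_gammaQuarterMeasure`); (b) the three-term recurrence `X𝒫_{n+1} = ᾱ_{n+1}𝒫_{n+2} + α_n𝒫_n`,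
`α_n = i a_n` (seat t12's `CCM2024_prop_3_3_ii_holds`), whence `𝒫_n(A)δ_0 = iⁿδ_n` and `𝒫̄_n(A)δ_0 = (−i)ⁿδ_n`
(`aeval_jacobi_single_of_recurrence`); with the symmetry `(p(A)δ_k)_j = (p(A)δ_j)_k` of the Jacobi matrix this gives
`∫ 𝒫̄_n 𝒫_m dm = iᵐ(−i)ⁿδ_{nm} = δ_{nm}`.

## What is proved

* `jacobi_single_zero`, `jacobi_single_succ`, `jacobi_pow_single_symm`, `aeval_jacobi_single_symm`,
  `aeval_jacobi_single_of_recurrence` (Favard's mechanism, general `a_n ≠ 0`, `ε² = −1`), `htAlpha_natCast`,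
  `conj_htAlpha_natCast`, `aeval_jacobi_htPoly`, `aeval_jacobi_htPoly_conj`, `integral_eval_gammaQuarterMeasure`,
  `integral_conj_htPoly_mul_htPoly`, `CCM2024_thm_3_1_ii_holds : CCM2024_thm_3_1_ii` (net debt −1).
-/

noncomputable section

open Finset Real MeasureTheory Polynomial Complex
open scoped Nat ComplexConjugate

namespace Literature.NumberTheory.ConnesConsani2024

open Literature.NumberTheory.LFunctions

section Orthonormality

/-- Row `0` of the Jacobi matrix: `(Av)_0 = a_0 v_1` (plumbing). [cite: ConnesConsaniMoscovici2024, §5.2 eq. (matrixA) p0017:L69; §2.1 eq. (9) p. 7 (p0006:L49)] -/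
private theorem jacobi_apply_zero' (a : ℕ → ℂ) (v : ℕ → ℂ) : jacobi a v 0 = a 0 * v 1 := by
  simp [jacobi]

/-- Row `m+1` of the Jacobi matrix: `(Av)_{m+1} = a_{m+1} v_{m+2} + a_m v_m` (plumbing). [cite: ConnesConsaniMoscovici2024, §5.2 eq. (matrixA) p0017:L69; §2.1 eq. (9) p. 7 (p0006:L49)] -/
private theorem jacobi_apply_succ' (a : ℕ → ℂ) (v : ℕ → ℂ) (m : ℕ) :
    jacobi a v (m + 1) = a (m + 1) * v (m + 2) + a m * v m := by
  simp [jacobi]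

/-- `A δ_0 = a_0 δ_1` (the three-term recurrence (9) on the basis, first column). [cite: ConnesConsaniMoscovici2024, §5.2 eq. (matrixA) p0017:L69; §2.1 eq. (9) p. 7 (p0006:L49)] -/
theorem jacobi_single_zero (a : ℕ → ℂ) :
    jacobi a (Pi.single 0 1) = a 0 • (Pi.single 1 1 : ℕ → ℂ) := by
  ext m
  rcases m with _ | m
  · rw [jacobi_apply_zero']; simp
  · rw [jacobi_apply_succ', Pi.smul_apply, smul_eq_mul]
    rcases m with _ | m
    · simp
    · simp

/-- `A δ_{j+1} = a_j δ_j + a_{j+1} δ_{j+2}` (the three-term recurrence (9) on the basis). [cite: ConnesConsaniMoscovici2024, §5.2 eq. (matrixA) p0017:L69; §2.1 eq. (9) p. 7 (p0006:L49)] -/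
theorem jacobi_single_succ (a : ℕ → ℂ) (j : ℕ) :
    jacobi a (Pi.single (j + 1) 1) = a j • (Pi.single j 1 : ℕ → ℂ) + a (j + 1) • (Pi.single (j + 2) 1 : ℕ → ℂ) := by
  ext m
  rcases m with _ | m
  · rw [jacobi_apply_zero', Pi.add_apply, Pi.smul_apply, Pi.smul_apply, smul_eq_mul, smul_eq_mul]
    rcases j with _ | j
    · simp
    · simp
  · rw [jacobi_apply_succ', Pi.add_apply, Pi.smul_apply, Pi.smul_apply, smul_eq_mul, smul_eq_mul]
    simp only [Pi.single_apply]
    by_cases h1 : m + 1 = j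
    · subst h1; simp [show m ≠ m + 1 + 1 by omega]
    · by_cases h2 : m = j + 1
      · subst h2; simp [show j + 1 + 1 ≠ j by omega]
      · have h3 : ¬ (m + 2 = j + 1) := by omega
        simp [h1, h2, h3]

/-- Symmetry of the matrix entries of the powers of the (symmetric) Jacobi matrix: `(Aʳ δ_k)_j = (Aʳ δ_j)_k`. [cite: ConnesConsaniMoscovici2024, §2.2 p. 7–8 (p0007:L84–L97); §5.2 eq. (matrixA) p0017:L66–L69] -/
theorem jacobi_pow_single_symm (a : ℕ → ℂ) :
    ∀ r j k : ℕ, ((jacobi a) ^ r) (Pi.single k 1) j = ((jacobi a) ^ r) (Pi.single j 1) k := by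
  intro r
  induction r with
  | zero =>
    intro j k
    simp only [pow_zero, Module.End.one_apply, Pi.single_apply]
    by_cases h : j = k
    · subst h; simp
    · simp [h, Ne.symm h]
  | succ r ih =>
    intro j k
    have eL : ((jacobi a) ^ (r + 1)) (Pi.single k 1) j = jacobi a (((jacobi a) ^ r) (Pi.single k 1)) j := by
      rw [pow_succ', Module.End.mul_apply]
    have eR : ((jacobi a) ^ (r + 1)) (Pi.single j 1) k = ((jacobi a) ^ r) (jacobi a (Pi.single j 1)) k := by
      rw [pow_succ, Module.End.mul_apply]
    rw [eL, eR]
    rcases j with _ | j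
    · rw [jacobi_apply_zero', jacobi_single_zero, map_smul, Pi.smul_apply, smul_eq_mul, ih 1 k]
    · rw [jacobi_apply_succ', jacobi_single_succ, map_add, map_smul, map_smul, Pi.add_apply, Pi.smul_apply,
        Pi.smul_apply, smul_eq_mul, smul_eq_mul, ih (j + 2) k, ih j k]
      ring

/-- The same symmetry for `p(A)`, `p` a polynomial. [cite: ConnesConsaniMoscovici2024, §2.2 p. 7–8 (p0007:L84–L97); §5.2 eq. (matrixA) p0017:L66–L69] -/
theorem aeval_jacobi_single_symm (a : ℕ → ℂ) (p : ℂ[X]) (j k : ℕ) :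
    (aeval (jacobi a) p) (Pi.single k 1) j = (aeval (jacobi a) p) (Pi.single j 1) k := by
  rw [aeval_eq_sum_range]
  simp only [LinearMap.coe_sum, Finset.sum_apply, LinearMap.smul_apply, Pi.smul_apply, smul_eq_mul,
    jacobi_pow_single_symm a _ j k]

/-- **Favard's mechanism** ("apply the general theory of orthogonal polynomials"): polynomials with `Q_0 = 1`,
`X Q_0 = −εa_0 Q_1`, `X Q_{n+1} = −εa_{n+1} Q_{n+2} + εa_n Q_n` (`ε² = −1`, `a_n ≠ 0` — the shape of Prop. 3.3 (ii) with
`α_n = i a_n`) satisfy `Q_n(A) δ_0 = εⁿ δ_n` for the Jacobi matrix `A` of the `a_n`. [cite: ConnesConsaniMoscovici2024, §2 p. 6 (p0006:L3) "apply the general theory of orthogonal polynomials"; Prop. 3.3 (ii) eq. (26) p. 12 (p0009:L90)] -/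
theorem aeval_jacobi_single_of_recurrence (a : ℕ → ℂ) (ha : ∀ n, a n ≠ 0) (ε : ℂ) (hε : ε ^ 2 = -1)
    (Q : ℕ → ℂ[X]) (h0 : Q 0 = 1) (h1 : X * Q 0 = (-ε * a 0) • Q 1)
    (hrec : ∀ n : ℕ, X * Q (n + 1) = (-ε * a (n + 1)) • Q (n + 2) + (ε * a n) • Q n) :
    ∀ n : ℕ, (aeval (jacobi a) (Q n)) (Pi.single 0 1) = ε ^ n • (Pi.single n 1 : ℕ → ℂ) := by
  have hε0 : ε ≠ 0 := by rintro rfl; norm_num at hε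
  have hεε : ε * ε = -1 := by rw [← sq]; exact hε
  have hQ0 : (aeval (jacobi a) (Q 0)) (Pi.single 0 1) = (Pi.single 0 1 : ℕ → ℂ) := by rw [h0]; simp
  -- `Q_1(A) δ_0 = ε δ_1`
  have hQ1 : (aeval (jacobi a) (Q 1)) (Pi.single 0 1) = ε • (Pi.single 1 1 : ℕ → ℂ) := by
    have h := congrArg (fun p => (aeval (jacobi a) p) (Pi.single (0 : ℕ) (1 : ℂ))) h1
    simp only [map_mul, map_smul, aeval_X, Module.End.mul_apply, LinearMap.smul_apply, hQ0, jacobi_single_zero] at h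
    -- h : a 0 • δ_1 = (-ε * a 0) • Q_1(A) δ_0
    have hc : (-ε * a 0) ≠ 0 := mul_ne_zero (neg_ne_zero.mpr hε0) (ha 0)
    have h2 : (aeval (jacobi a) (Q 1)) (Pi.single 0 1) = (-ε * a 0)⁻¹ • (a 0 • (Pi.single 1 1 : ℕ → ℂ)) := by
      rw [h, smul_smul, inv_mul_cancel₀ hc, one_smul]
    rw [h2]
    have ha0 := ha 0
    match_scalars
    field_simp
    linear_combination (-(1 : ℂ)) * hεε
  -- two-step induction
  have key : ∀ n : ℕ, (aeval (jacobi a) (Q n)) (Pi.single 0 1) = ε ^ n • (Pi.single n 1 : ℕ → ℂ) ∧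
      (aeval (jacobi a) (Q (n + 1))) (Pi.single 0 1) = ε ^ (n + 1) • (Pi.single (n + 1) 1 : ℕ → ℂ) := by
    intro n
    induction n with
    | zero => exact ⟨by simpa using hQ0, by simpa using hQ1⟩
    | succ n ih =>
      obtain ⟨ihn, ihn1⟩ := ih
      refine ⟨ihn1, ?_⟩
      have h := congrArg (fun p => (aeval (jacobi a) p) (Pi.single (0 : ℕ) (1 : ℂ))) (hrec n)
      simp only [map_mul, map_add, map_smul, aeval_X, Module.End.mul_apply, LinearMap.add_apply,
        LinearMap.smul_apply, ihn, ihn1, map_smul, jacobi_single_succ] at h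
      -- h : ε^(n+1) • (a n • δ_n + a (n+1) • δ_(n+2)) = (-ε * a (n+1)) • Q_(n+2)(A) δ_0 + (ε * a n) • ε^n • δ_n
      have hc : (-ε * a (n + 1)) ≠ 0 := mul_ne_zero (neg_ne_zero.mpr hε0) (ha (n + 1))
      have h' : (-ε * a (n + 1)) • (aeval (jacobi a) (Q (n + 2))) (Pi.single 0 1) =
          ε ^ (n + 1) • (a n • (Pi.single n 1 : ℕ → ℂ) + a (n + 1) • (Pi.single (n + 2) 1 : ℕ → ℂ))
            - (ε * a n) • ε ^ n • (Pi.single n 1 : ℕ → ℂ) :=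
        eq_sub_of_add_eq h.symm
      have h2 : (aeval (jacobi a) (Q (n + 2))) (Pi.single 0 1) =
          (-ε * a (n + 1))⁻¹ • (ε ^ (n + 1) • (a n • (Pi.single n 1 : ℕ → ℂ) + a (n + 1) • (Pi.single (n + 2) 1 : ℕ → ℂ))
            - (ε * a n) • ε ^ n • (Pi.single n 1 : ℕ → ℂ)) := by
        rw [← h', smul_smul, inv_mul_cancel₀ hc, one_smul]
      rw [show n + 1 + 1 = n + 2 by ring, h2]
      have haN := ha (n + 1)
      have haN' := ha n
      match_scalars
      · field_simp; ring
      · field_simp; linear_combination (-(ε ^ n * ε)) * hεε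
  exact fun n => (key n).1

/-- `α_n = i a_n` (`n : ℕ`): the off-diagonal entries (26) versus `a_n = ½√((2n+1)(2n+2))` (`metaA`). [cite: ConnesConsaniMoscovici2024, §2 p. 6 (p0006:L3) "apply the general theory of orthogonal polynomials"; Prop. 3.3 (ii) eq. (26) p. 12 (p0009:L90)] -/
theorem htAlpha_natCast (n : ℕ) : htAlpha n = I * (metaA n : ℂ) := by
  rw [htAlpha, metaA]; push_cast; ring

/-- `ᾱ_n = −i a_n` (`n : ℕ`). [cite: ConnesConsaniMoscovici2024, §2 p. 6 (p0006:L3) "apply the general theory of orthogonal polynomials"; Prop. 3.3 (ii) eq. (26) p. 12 (p0009:L90)] -/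
theorem conj_htAlpha_natCast (n : ℕ) : conj (htAlpha n) = -I * (metaA n : ℂ) := by
  rw [htAlpha_natCast, map_mul, Complex.conj_I, Complex.conj_ofReal]

/-- `a_n ≠ 0` in `ℂ` (plumbing). [folklore] -/
private theorem metaA_ne_zero' (n : ℕ) : (metaA n : ℂ) ≠ 0 := by exact_mod_cast (metaA_pos n).ne'

/-- `𝒫_0 = 1` (plumbing, from seat t12's `htPolyS_zero`). [cite: ConnesConsaniMoscovici2024, §2 p. 6 (p0006:L3) "apply the general theory of orthogonal polynomials"; Prop. 3.3 (ii) eq. (26) p. 12 (p0009:L90)] -/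
private theorem htPoly_zero' : htPoly 0 = 1 := by
  rw [htPoly_eq_smul_htPolyS, htPolyS_zero]; simp

/-- `𝒫_n(A) δ_0 = iⁿ δ_n` for the Jacobi matrix `A` of `a_n = ½√((2n+1)(2n+2))`, from the recurrence Prop. 3.3 (ii)
(seat t12's `CCM2024_prop_3_3_ii_holds`) — "after rescaling by powers of `i`" (Thm 5.2 (iii), proof). [cite: ConnesConsaniMoscovici2024, §2 p. 6 (p0006:L3) "apply the general theory of orthogonal polynomials"; Prop. 3.3 (ii) eq. (26) p. 12 (p0009:L90)] -/
theorem aeval_jacobi_htPoly (n : ℕ) :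
    (aeval (jacobi fun k => (metaA k : ℂ)) (htPoly n)) (Pi.single 0 1) = I ^ n • (Pi.single n 1 : ℕ → ℂ) := by
  refine aeval_jacobi_single_of_recurrence (fun k => (metaA k : ℂ)) metaA_ne_zero' I Complex.I_sq htPoly htPoly_zero' ?_ ?_ n
  · have h := CCM2024_prop_3_3_ii_holds.1
    rw [← smul_eq_C_mul] at h
    rw [h]; congr 1
    exact_mod_cast conj_htAlpha_natCast 0
  · intro n
    have h := CCM2024_prop_3_3_ii_holds.2 n
    rw [← smul_eq_C_mul, ← smul_eq_C_mul] at h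
    rw [h]; congr 2
    · exact_mod_cast conj_htAlpha_natCast (n + 1)
    · exact htAlpha_natCast n

/-- `𝒫̄_n(A) δ_0 = (−i)ⁿ δ_n` for the coefficientwise conjugates `𝒫̄_n` (conjugate recurrence). [cite: ConnesConsaniMoscovici2024, §2 p. 6 (p0006:L3) "apply the general theory of orthogonal polynomials"; Prop. 3.3 (ii) eq. (26) p. 12 (p0009:L90)] -/
theorem aeval_jacobi_htPoly_conj (n : ℕ) :
    (aeval (jacobi fun k => (metaA k : ℂ)) ((htPoly n).map (starRingEnd ℂ))) (Pi.single 0 1) =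
      (-I) ^ n • (Pi.single n 1 : ℕ → ℂ) := by
  refine aeval_jacobi_single_of_recurrence (fun k => (metaA k : ℂ)) metaA_ne_zero' (-I) (by rw [neg_sq, Complex.I_sq])
    (fun n => (htPoly n).map (starRingEnd ℂ)) (by rw [htPoly_zero', Polynomial.map_one]) ?_ ?_ n
  · have h := congrArg (Polynomial.map (starRingEnd ℂ)) CCM2024_prop_3_3_ii_holds.1
    rw [Polynomial.map_mul, Polynomial.map_X, Polynomial.map_mul, Polynomial.map_C, Complex.conj_conj,
      ← smul_eq_C_mul] at h
    rw [h]; congr 1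
    have e := htAlpha_natCast 0
    push_cast at e
    rw [e]; ring
  · intro n
    have h := congrArg (Polynomial.map (starRingEnd ℂ)) (CCM2024_prop_3_3_ii_holds.2 n)
    rw [Polynomial.map_mul, Polynomial.map_X, Polynomial.map_add, Polynomial.map_mul, Polynomial.map_C,
      Polynomial.map_mul, Polynomial.map_C, Complex.conj_conj, ← smul_eq_C_mul, ← smul_eq_C_mul] at h
    rw [h]; congr 2
    · have := htAlpha_natCast (n + 1); push_cast at this ⊢; rw [this]; ring
    · rw [conj_htAlpha_natCast n]

/-- **The moment functional of `dm` is the Jacobi functional**: `∫ p(s) dm(s) = (p(A) δ_0)_0` for every polynomial `p`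
(linearity over the PROVED moments `∫ sⁿ dm = c_n = (Aⁿ)_{00}`, `integral_pow_gammaQuarterMeasure_eq_metaMoment`). [cite: ConnesConsaniMoscovici2024, Thm. 2.1 (iii) p. 6 (p0006:L11) (`∫ f dμ = ⟨f(D)ξ|ξ⟩`); Thm 5.2 (iii) p0018:L71] -/
theorem integral_eval_gammaQuarterMeasure (p : ℂ[X]) :
    ∫ s : ℝ, p.eval (s : ℂ) ∂gammaQuarterMeasure =
      (aeval (jacobi fun k => (metaA k : ℂ)) p) (Pi.single 0 1) 0 := by
  have hint : ∀ i : ℕ, Integrable (fun s : ℝ => p.coeff i * (s : ℂ) ^ i) gammaQuarterMeasure := by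
    intro i
    have h := (integrable_pow_gammaQuarterMeasure i).ofReal (𝕜 := ℂ)
    refine (h.const_mul (p.coeff i)).congr (Filter.Eventually.of_forall fun s => ?_)
    simp
  have hfun : (fun s : ℝ => p.eval (s : ℂ)) =
      fun s : ℝ => ∑ i ∈ Finset.range (p.natDegree + 1), p.coeff i * (s : ℂ) ^ i := by
    funext s; rw [eval_eq_sum_range]
  rw [hfun, integral_finsetSum _ (fun i _ => hint i)]
  simp_rw [integral_const_mul, integral_pow_gammaQuarterMeasure_eq_metaMoment]
  rw [aeval_eq_sum_range]
  simp only [LinearMap.coe_sum, Finset.sum_apply, LinearMap.smul_apply, Pi.smul_apply, smul_eq_mul]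
  rfl

/-- `conj (p(s)) = p̄(s)` for real `s`, `p̄` the coefficientwise conjugate (plumbing). [folklore] -/
private theorem conj_eval_ofReal (p : ℂ[X]) (s : ℝ) :
    conj (p.eval (s : ℂ)) = (p.map (starRingEnd ℂ)).eval (s : ℂ) := by
  rw [eval_map, ← eval₂_id (x := (s : ℂ)) (p := p), hom_eval₂, Complex.conj_ofReal]
  rfl

/-- **Orthonormality of the `𝒫_n` in `L²(dm)`** (Theorem 3.1 (ii): "the `𝒫_n` are the orthonormal polynomials for the
measure `dm`"; Prop. 3.3 (i)): `∫ conj(𝒫_n)𝒫_m dm = δ_{nm}` — PROVED from the moments of `dm` (Thm 5.2 (iii),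
`ProlateWaveMomentsJacobi.lean`) and the three-term recurrence (Prop. 3.3 (ii), seat t12) by Favard's mechanism:
`∫ 𝒫̄_n𝒫_m dm = ((𝒫̄_n𝒫_m)(A)δ_0)_0 = iᵐ(𝒫̄_n(A)δ_m)_0 = iᵐ(𝒫̄_n(A)δ_0)_m = iᵐ(−i)ⁿ δ_{nm}`. [cite: ConnesConsaniMoscovici2024, Thm. 3.1 (ii) p. 9 (p0008:L9); Prop. 3.3 (i) p. 11 (p0009:L27); Thm 5.2 (iii) p0018:L71] -/
theorem integral_conj_htPoly_mul_htPoly (n m : ℕ) :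
    ∫ s : ℝ, conj ((htPoly n).eval (s : ℂ)) * (htPoly m).eval (s : ℂ) ∂htMeasure = if n = m then 1 else 0 := by
  rw [← gammaQuarterMeasure_eq_htMeasure]
  have hfun : (fun s : ℝ => conj ((htPoly n).eval (s : ℂ)) * (htPoly m).eval (s : ℂ)) =
      fun s : ℝ => ((htPoly n).map (starRingEnd ℂ) * htPoly m).eval (s : ℂ) := by
    funext s; rw [eval_mul, conj_eval_ofReal]
  rw [hfun, integral_eval_gammaQuarterMeasure, map_mul, Module.End.mul_apply, aeval_jacobi_htPoly, map_smul,
    Pi.smul_apply, aeval_jacobi_single_symm, aeval_jacobi_htPoly_conj, Pi.smul_apply, smul_eq_mul, smul_eq_mul,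
    Pi.single_apply]
  by_cases h : n = m
  · subst h
    simp only [if_true]
    rw [mul_one, ← mul_pow]
    simp
  · rw [if_neg (Ne.symm h), if_neg h, mul_zero, mul_zero]

/-- **Discharge of the named fact `CCM2024_thm_3_1_ii`** (Theorem 3.1 (ii), measure-theoretic content as typed in
`ProlateWaveCyclicPairs.lean` by seat t12 after p428964: the `𝒫_n` are orthonormal in `L²(dm)`; the mass clause is seat t10's
`isProbabilityMeasure_htMeasure`). [cite: ConnesConsaniMoscovici2024, Thm. 3.1 (ii) p. 9 (p0008:L9); Prop. 3.3 (i) p. 11 (p0009:L27); Thm 5.2 (iii) p0018:L71] -/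
theorem CCM2024_thm_3_1_ii_holds : CCM2024_thm_3_1_ii :=
  fun n m => integral_conj_htPoly_mul_htPoly n m

end Orthonormality

end Literature.NumberTheory.ConnesConsani2024
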